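import Literature.Computability.AlgebraicComplexity.TransvectionInvariantForms
import Literature.Computability.AlgebraicComplexity.TransvectionChartCount
import Mathlib.LinearAlgebra.Matrix.SchurComplement
import HarnessLib

/-!
# Generic forms admit no transvection symmetry (positive characteristic, every field)

Topic `Literature/Computability/AlgebraicComplexity` (cell `val-lit`, row X3-Poonen05). Theorems only —
no definition, no named fact.

The transvection class in the Matsumura–Monsky count behind Poonen 2005 Thm. 3 ("the generic
hypersurface has `Lin X = {1}`"), in characteristic `p > 0` (the only characteristic in which a
transvection `1 + a ψᵀ`, `ψ(a) = 0`, has finite order): over EVERY field of characteristic `p`, for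
`D ≥ 3`, `m ≥ 3`, `(D, m) ≠ (3, 3)`, almost all forms of degree `D` in `m` variables have no
transvection in their stabilizer.

* § 1 The chart. For `i ≠ j`, a vector `a` and a covector `ψ` with `ψ_j = 1`, `ψ(a) = 0`, the matrix
  `P = (1 + (a - e_i) e_iᵀ)(1 - e_j φᵀ)` (`φ = ψ` off `{i, j}`, `0` on `{i, j}`; columns
  `P e_i = a`, `P e_j = e_j`, `P e_k = e_k - ψ_k e_j`) has `det P = a_i` (`transvectionChart_det`) and
  conjugates the model `τ₀ = 1 + E_{ij}` (`x_j ↦ x_j + x_i`) to `1 + a ψᵀ`: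
  `(1 + a ψᵀ) P = P τ₀` (`transvectionChart_conj`; `ψᵀ P = e_jᵀ`, `P e_i = a`).
* § 2 **`isZariskiGeneric_forall_mem_linStabilizer_not_transvection`** — the generic statement: the
  universal chart has `2(m - 1)` polynomial parameters (`a_k`, `ψ_k`, `k ≠ j`; `a_j = -∑ ψ_k a_k`),
  the fixed forms of `τ₀` span at most `#T` dimensions (`finrank_fixedForms_transvection_le_card`,
  Dickson / Landweber–Stong invariants), and `2(m-1) + #T < N` (`card_transvectionChart_lt`); every
  transvection `1 + a ψᵀ ≠ 1` is reached by one of the `m(m-1)` charts `(i, j)` after rescaling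
  `(a, ψ) ↦ (ψ_j a, ψ_j⁻¹ ψ)`.

Honest framing / what stays open. Characteristic `0` is covered by the tree's
`isZariskiGeneric_hasTrivialStabilizer_of_charZero`; the unipotent classes of rank `≥ 2` (`m ≥ 4`)
are NOT treated — the general residue of `poonen2005_thm_3` stays XL and unclaimed; `m = 3` is
completed by the same seat (`TernaryRegularUnipotentStabilizer` + the assembly file). Classical
([MatsumuraMonsky1963], [Poonen2005], [NeuselSmith2010]); typed ≠ endorsed; nothing here bears on VP
versus VNP, which is NOT proved.

## References

* B. Poonen, *Varieties without extra automorphisms III: hypersurfaces*, Finite Fields Appl. 11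
  (2005) 230–268, Thm. 3 (held, p0002:L17–21). [Poonen2005]
* H. Matsumura, P. Monsky, *On the automorphisms of hypersurfaces*, J. Math. Kyoto Univ. 3 (1963/64)
  347–361 (not held, acq-11400). [MatsumuraMonsky1963]
* M. Neusel, L. Smith, *Invariant Theory of Finite Groups*, AMS (2002/2010), §6.2 (p0162–p0165,
  transvections `t(φ, x)`), §6.3 Example 1 (p0167). [NeuselSmith2010]

## Tree

`isZariskiGeneric_forall_mem_linStabilizer_mul_ne` (`GenericSubspaceChartCriterion`),
`finrank_fixedForms_transvection_le_card` (`TransvectionInvariantForms`), `card_transvectionChart_lt`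
(`TransvectionChartCount`), `IsZariskiGeneric.forall_fintype`, `linStabilizer`.

## Provenance

Cell `val-lit`, seat `val-lit-x3` generation 9 (cross-ladder literature seat; row X3 residue).
-/

noncomputable section

open MvPolynomial Matrix

namespace Literature.Computability.AlgebraicComplexity

/-! ### § 1 The chart of transvections -/

section Chart

variable {m : ℕ} {K : Type*} [Field K]

/-- **`det P = a_i`** for the chart `P = (1 + (a - e_i) e_iᵀ)(1 - e_j φᵀ)` with `φ_j = 0` (matrix
determinant lemma twice: `det(1 + u vᵀ) = 1 + v ⋅ u`). [cite: Poonen2005, Thm. 3 (proof: dimension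
count of [MM]; chart of the transvection class)] -/
theorem transvectionChart_det {i j : Fin m} (a φ : Fin m → K) (hφj : φ j = 0) :
    ((1 + vecMulVec (a - Pi.single i 1) (Pi.single i 1)) *
        (1 - vecMulVec (Pi.single j 1) φ)).det = a i := by
  have hU : (1 : Matrix (Fin m) (Fin m) K) - vecMulVec (Pi.single j 1) φ =
      1 + vecMulVec (-Pi.single j 1) φ := by
    rw [neg_vecMulVec, sub_eq_add_neg]
  rw [det_mul, hU, vecMulVec_eq (ι := Unit), vecMulVec_eq (ι := Unit),
    det_one_add_replicateCol_mul_replicateRow, det_one_add_replicateCol_mul_replicateRow,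
    single_one_dotProduct, Pi.sub_apply, Pi.single_eq_same, dotProduct_neg, dotProduct_single_one,
    hφj, neg_zero, add_zero, mul_one]
  ring

/-- **`ψᵀ P = e_jᵀ`** for the chart, when `ψ_j = 1`, `ψ(a) = 0` and `φ = ψ` off `{i, j}`.
[cite: Poonen2005, Thm. 3 (proof: dimension count of [MM]; chart of the transvection class)] -/
theorem vecMul_transvectionChart {i j : Fin m} (hij : i ≠ j) (a ψ : Fin m → K) (hψj : ψ j = 1)
    (hψa : ψ ⬝ᵥ a = 0) :
    ψ ᵥ* ((1 + vecMulVec (a - Pi.single i 1) (Pi.single i 1)) *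
        (1 - vecMulVec (Pi.single j 1) fun c => if c = i ∨ c = j then 0 else ψ c)) =
      Pi.single j 1 := by
  rw [← vecMul_vecMul, vecMul_add, vecMul_one, vecMul_vecMulVec, dotProduct_sub, hψa,
    dotProduct_single_one, zero_sub, vecMul_sub, vecMul_one, vecMul_vecMulVec, add_dotProduct,
    dotProduct_single_one, hψj, smul_dotProduct, single_one_dotProduct,
    Pi.single_eq_of_ne' hij.symm]  -- careful: Pi.single i 1 j = 0
  ext c
  simp only [Pi.sub_apply, Pi.add_apply, Pi.smul_apply, Pi.single_apply, smul_eq_mul]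
  by_cases hcj : c = j
  · subst hcj; simp [hij.symm, hψj]
  · by_cases hci : c = i
    · subst hci; simp [hcj]
    · simp [hcj, hci]

/-- **`P e_i = a`** for the chart (`φ_i = 0`). [cite: Poonen2005, Thm. 3 (proof: dimension count of
[MM]; chart of the transvection class)] -/
theorem transvectionChart_mulVec_single {i j : Fin m} (a ψ : Fin m → K) :
    ((1 + vecMulVec (a - Pi.single i 1) (Pi.single i 1)) *
        (1 - vecMulVec (Pi.single j 1) fun c => if c = i ∨ c = j then 0 else ψ c)) *ᵥ
      Pi.single i 1 = a := by
  rw [← mulVec_mulVec, sub_mulVec, one_mulVec, vecMulVec_mulVec, dotProduct_single_one]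
  simp only [true_or, if_true, MulOpposite.op_zero, zero_smul, sub_zero]
  rw [add_mulVec, one_mulVec, vecMulVec_mulVec, dotProduct_single_one, Pi.single_eq_same,
    MulOpposite.op_one, one_smul, add_sub_cancel]

/-- **The chart conjugates the model to the transvection**: `(1 + a ψᵀ) P = P (1 + E_{ij})`
(`ψ_j = 1`, `ψ(a) = 0`, `i ≠ j`). [cite: Poonen2005, Thm. 3 (proof: dimension count of [MM]; chart
of the transvection class)] -/
theorem transvectionChart_conj {i j : Fin m} (hij : i ≠ j) (a ψ : Fin m → K) (hψj : ψ j = 1)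
    (hψa : ψ ⬝ᵥ a = 0) :
    (1 + vecMulVec a ψ) * ((1 + vecMulVec (a - Pi.single i 1) (Pi.single i 1)) *
        (1 - vecMulVec (Pi.single j 1) fun c => if c = i ∨ c = j then 0 else ψ c)) =
      ((1 + vecMulVec (a - Pi.single i 1) (Pi.single i 1)) *
        (1 - vecMulVec (Pi.single j 1) fun c => if c = i ∨ c = j then 0 else ψ c)) *
        (1 + Matrix.single i j (1 : K)) := by
  rw [Matrix.add_mul, Matrix.one_mul, vecMulVec_mul, vecMul_transvectionChart hij a ψ hψj hψa,
    Matrix.mul_add, Matrix.mul_one, single_eq_single_vecMulVec_single, mul_vecMulVec,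
    transvectionChart_mulVec_single]

/-- The chart is compatible with ring homomorphisms (specialising the universal chart).
[cite: Poonen2005, Thm. 3 (proof: dimension count of [MM]; chart of the transvection class)] -/
theorem transvectionChart_map {R S : Type*} [CommRing R] [CommRing S] (f : R →+* S) (i j : Fin m)
    (A Φ : Fin m → R) :
    ((1 + vecMulVec (A - Pi.single i 1) (Pi.single i 1)) * (1 - vecMulVec (Pi.single j 1) Φ)).map f =
      (1 + vecMulVec ((fun r => f (A r)) - Pi.single i 1) (Pi.single i 1)) *
        (1 - vecMulVec (Pi.single j 1) fun c => f (Φ c)) := by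
  rw [← RingHom.mapMatrix_apply, map_mul, map_add, map_sub, map_one]
  simp only [RingHom.mapMatrix_apply]
  congr 2
  · ext r c
    simp only [Matrix.map_apply, vecMulVec_apply, map_mul, map_sub, Pi.sub_apply, Pi.single_apply]
    congr 2 <;> split_ifs <;> simp
  · ext r c
    simp only [Matrix.map_apply, vecMulVec_apply, map_mul, Pi.single_apply]
    congr 1
    split_ifs <;> simp

end Chart

/-! ### § 2 Generic forms have no transvection symmetry -/

section Generic

variable {m : ℕ} {K : Type*} [Field K] {D : ℕ}

/-- Rescaling a transvection: `(ψ_j a)(ψ_j⁻¹ ψ)ᵀ = a ψᵀ`. [cite: NeuselSmith2010, §6.2 (p0162,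
`ψ = a · φ` for the hyperplane functional)] -/
theorem vecMulVec_smul_inv_smul {j : Fin m} (a ψ : Fin m → K) (hj : ψ j ≠ 0) :
    vecMulVec (ψ j • a) ((ψ j)⁻¹ • ψ) = vecMulVec a ψ := by
  rw [smul_vecMulVec, vecMulVec_smul, smul_smul, mul_inv_cancel₀ hj, one_smul]

/-- **Generic forms admit no transvection symmetry** (every field of characteristic `p > 0`; `D ≥ 3`,
`m ≥ 3`, `(D, m) ≠ (3, 3)`): for almost all forms `f` of degree `D` in `m` variables, no element of
`stab(f)` is a transvection `1 + a ψᵀ` (`ψ(a) = 0`, `a ψᵀ ≠ 0`). The transvection class in the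
Matsumura–Monsky count: chart `P = (1 + (a - e_i) e_iᵀ)(1 - e_j φᵀ)` in `2(m-1)` parameters,
`dim (Sym^D)^{τ₀} ≤ #T` (Dickson / Landweber–Stong invariants of `τ₀ : x_j ↦ x_j + x_i`), and
`2(m-1) + #T < N`. [cite: Poonen2005, Thm. 3 (proof: dimension count of [MM]; transvection class)] -/
theorem isZariskiGeneric_forall_mem_linStabilizer_not_transvection {p : ℕ} [Fact p.Prime]
    [CharP K p] (hD : 3 ≤ D) (hm : 3 ≤ m) (h33 : D = 3 → 4 ≤ m) :
    IsZariskiGeneric D fun f : MvPolynomial (Fin m) K =>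
      ∀ u ∈ linStabilizer f, ∀ a ψ : Fin m → K, ψ ⬝ᵥ a = 0 →
        (u : Matrix (Fin m) (Fin m) K) = 1 + vecMulVec a ψ → vecMulVec a ψ = 0 := by
  classical
  -- the universal chart for the pair `(i, j) = q`, parameters `a_k` (`inl k`) and `ψ_k` (`inr k`), `k ≠ j`
  let G : ∀ q : {q : Fin m × Fin m // q.1 ≠ q.2},
      Matrix (Fin m) (Fin m) (MvPolynomial ({k : Fin m // k ≠ q.1.2} ⊕ {k : Fin m // k ≠ q.1.2}) K) :=
    fun q =>
      (1 + vecMulVec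
          ((fun r : Fin m => if h : r = q.1.2 then
              -∑ k : {k : Fin m // k ≠ q.1.2}, X (Sum.inr k) * X (Sum.inl k)
            else X (Sum.inl ⟨r, h⟩)) - Pi.single q.1.1 1)
          (Pi.single q.1.1 1)) *
        (1 - vecMulVec (Pi.single q.1.2 1) fun c : Fin m =>
          if c = q.1.1 ∨ c = q.1.2 then 0
          else if h : c = q.1.2 then 0 else X (Sum.inr ⟨c, h⟩))
  have hgen := fun q : {q : Fin m × Fin m // q.1 ≠ q.2} =>
    isZariskiGeneric_forall_mem_linStabilizer_mul_ne D (G q) (1 + Matrix.single q.1.1 q.1.2 (1 : K))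
      (by
        have h1 := finrank_fixedForms_transvection_le_card (K := K) (p := p) q.2 D
        have h2 := card_transvectionChart_lt (m := m) p hD hm h33 q.2
        omega)
  obtain ⟨F, hF0, hF⟩ := IsZariskiGeneric.forall_fintype hgen
  refine ⟨F, hF0, fun f hf hFf u hu a ψ hψa hu1 => ?_⟩
  by_contra hne
  -- `a ≠ 0`, `ψ ≠ 0`; rescale so that `ψ_j = 1`
  have ha : a ≠ 0 := fun h => hne (by rw [h]; exact vecMulVec_eq_zero.mpr (Or.inl rfl))
  have hψ : ψ ≠ 0 := fun h => hne (by rw [h]; exact vecMulVec_eq_zero.mpr (Or.inr rfl))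
  obtain ⟨j, hψj⟩ := Function.ne_iff.mp hψ
  set a' : Fin m → K := ψ j • a with ha'
  set ψ' : Fin m → K := (ψ j)⁻¹ • ψ with hψ'
  have hψ'j : ψ' j = 1 := by rw [hψ', Pi.smul_apply, smul_eq_mul, inv_mul_cancel₀ hψj]
  have hψ'a' : ψ' ⬝ᵥ a' = 0 := by
    rw [hψ', ha', smul_dotProduct, dotProduct_smul, hψa, smul_zero, smul_zero]
  have hu1' : (u : Matrix (Fin m) (Fin m) K) = 1 + vecMulVec a' ψ' := by
    rw [hu1, ha', hψ', vecMulVec_smul_inv_smul a ψ hψj]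
  have ha' : a' ≠ 0 := by
    rw [ha']; exact smul_ne_zero hψj ha
  -- an index `i ≠ j` with `a'_i ≠ 0`
  obtain ⟨i, hij, hai⟩ : ∃ i : Fin m, i ≠ j ∧ a' i ≠ 0 := by
    by_contra hall
    push Not at hall
    have haj : a' j = 0 := by
      have := hψ'a'
      rw [dotProduct, Finset.sum_eq_single j (fun k _ hk => by rw [hall k hk, mul_zero])
        (fun h => absurd (Finset.mem_univ j) h), hψ'j, one_mul] at this
      exact this
    exact ha' (funext fun k => by
      by_cases hk : k = j
      · rw [hk, haj, Pi.zero_apply]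
      · rw [hall k hk, Pi.zero_apply])
  -- specialise the chart `(i, j)` at `π = (a'_k, ψ'_k)_{k ≠ j}`
  let q : {q : Fin m × Fin m // q.1 ≠ q.2} := ⟨(i, j), hij⟩
  let π : {k : Fin m // k ≠ j} ⊕ {k : Fin m // k ≠ j} → K :=
    Sum.elim (fun k => a' k) (fun k => ψ' k)
  have hsum : -∑ k : {k : Fin m // k ≠ j}, ψ' k * a' k = a' j := by
    have h1 : ∑ k : {k : Fin m // k ≠ j}, ψ' k * a' k =
        ∑ k ∈ (Finset.univ : Finset (Fin m)).erase j, ψ' k * a' k :=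
      (Finset.sum_subtype ((Finset.univ : Finset (Fin m)).erase j) (fun k => by simp)
        (fun k => ψ' k * a' k)).symm
    have h2 := Finset.add_sum_erase (Finset.univ : Finset (Fin m)) (fun k => ψ' k * a' k)
      (Finset.mem_univ j)
    have h3 : ∑ k ∈ (Finset.univ : Finset (Fin m)), ψ' k * a' k = 0 := hψ'a'
    rw [h1]
    rw [h3, hψ'j, one_mul] at h2
    linear_combination (-1 : K) * h2
  have hx : (fun r : Fin m => MvPolynomial.eval π (if h : r = j then
        -∑ k : {k : Fin m // k ≠ j}, X (Sum.inr k) * X (Sum.inl k) else X (Sum.inl ⟨r, h⟩))) = a' := by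
    funext r
    by_cases h : r = j
    · subst h
      rw [dif_pos rfl, map_neg, map_sum]
      simp only [map_mul, MvPolynomial.eval_X, π, Sum.elim_inr, Sum.elim_inl]
      exact hsum
    · rw [dif_neg h, MvPolynomial.eval_X]
      simp [π]
  have hw : (fun c : Fin m => MvPolynomial.eval π (if c = i ∨ c = j then 0
        else if h : c = j then 0 else X (Sum.inr ⟨c, h⟩))) =
      fun c => if c = i ∨ c = j then 0 else ψ' c := by
    funext c
    by_cases h : c = i ∨ c = j
    · rw [if_pos h, if_pos h, map_zero]
    · have hcj : ¬ c = j := fun h' => h (Or.inr h')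
      rw [if_neg h, if_neg h, dif_neg hcj, MvPolynomial.eval_X]
      simp [π]
  have hmap : (G q).map (MvPolynomial.eval π) =
      (1 + vecMulVec (a' - Pi.single i 1) (Pi.single i 1)) *
        (1 - vecMulVec (Pi.single j 1) fun c => if c = i ∨ c = j then 0 else ψ' c) := by
    simp only [G, q]
    rw [transvectionChart_map, hx, hw]
  have key := hF f hf hFf q u hu π
  rw [hmap, hu1'] at key
  exact key (by rw [transvectionChart_det a' _ (by simp)]; exact hai)
    (transvectionChart_conj hij a' ψ' hψ'j hψ'a')

end Generic

end Literature.Computability.AlgebraicComplexity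

end
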